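import Summits.NavierStokesRegularity.NavierStokesRegularity.Theorems.SymmetricLiouville.Negative.AncientLoadBearing
import Summits.NavierStokesRegularity.NavierStokesRegularity.Theorems.SymmetricLiouville.Negative.FinerCuts

/-!
# Crux `SymmetricLiouville` (stmt-NavierStokesRegularity-4053), negative side: load-bearing hypotheses

Negative-side (cdisprove, D-0016) support lemmas extracted from
`Cruxes/SymmetricLiouville/Disproof.lean` (v1/v5) of route `SymmetryModuliCount`. The crux says: a
smooth, divergence-free, KNSS-mild ancient field on `(−∞,0) × ℝ³` with Type-I time decay
`‖u(t,x)‖ ≤ C/√(−t)` which is annihilated by the generator `L_ξ` of a nonzero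
`ξ = (a, σ, A) ∈ sim(3)` vanishes identically. Here:

* `symmetricLiouville_iff` — the route decl unbundled (`Iff.rfl`) into the named clauses
  `IsSmoothAncient`, `IsDivFreeAncient`, `IsKNSSMild`, `HasTypeITimeDecay`, `IsSkew`, `HasSymmetry`,
  `VanishesOnPast` that the mutants below are written in;
* `symmetricLiouville_false_without_typeI` — with `HasTypeITimeDecay` deleted the crux is FALSE:
  the constant field `u ≡ f₀` is smooth, divergence free, KNSS-mild (constants ARE in the gauge class,
  KNSS 2009 Rem. 6.1) and translation invariant, yet nonzero — any proof must use the decay;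
* `symmetricLiouville_false_without_mild` — with the Oseen integral equation deleted the crux is
  FALSE: the parasitic field `u(t,x) = (1 − t)⁻¹ • f₀` (KNSS 2009 §1: the solutions `b(t)`,
  `∇p = −b'(t)·x` that the mild formulation removes) is smooth, divergence free, Type-I with `C = 1`
  and translation invariant — any proof must use the KNSS gauge (the statement is false verbatim in
  duality-form mild classes that do not see spatial constants);
* `symmetricLiouville_false_with_bounded` — Type-I decay replaced by boundedness: FALSE (constant
  field), so a bounded-ancient symmetric Liouville theorem can only conclude "`u` is constant".

Relation to the landed siblings. `AncientLoadBearing.lean` (shear wave: "ancient" is load-bearing)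
supplies the unit vector `f0`; `FinerCuts.lean` supplies the constant-field facts
(`isDivFree_fun_const`, `const_mild`, `translation_symm_of_spatially_const`) and already kills the
STRONGER-hypothesis mutants `SymmetricLiouvilleTypeINearZeroBoundedPast` (more hypotheses than
`SymmetricLiouvilleWithoutTypeI` / `SymmetricLiouvilleBounded`) and `SymmetricLiouvilleMildOnWindow T`
(more than `SymmetricLiouvilleWithoutMild`), so the three refutations below are also one-line
corollaries of those; this file's own content is the unbundling, the protocol's named
`<Crux>Without<H>` mutants, and the distinct parasitic witness `(1 − t)⁻¹ • f₀` of KNSS §1.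

No route statement is changed (`--supports`).
-/

noncomputable section

namespace Summit.NavierStokesRegularity.NavierStokesRegularity.Theorems.SymmetricLiouville.Negative

open Literature.Analysis.FluidPDE MeasureTheory Set Function
open scoped RealInnerProductSpace

open Summit.NavierStokesRegularity.NavierStokesRegularity.Theses.SymmetryModuliCount
  (SymmetricLiouville)

/-! ## The crux unbundled -/

/-- Smoothness clause of the class `𝒜_C`: `u` is jointly `C^∞` on `(−∞,0) × ℝ³`. -/
def IsSmoothAncient (u : ℝ → (EuclideanSpace ℝ (Fin 3)) → (EuclideanSpace ℝ (Fin 3))) : Prop :=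
  ContDiffOn ℝ (⊤ : ℕ∞) (Function.uncurry u) (Set.Iio 0 ×ˢ Set.univ)

/-- Divergence-free clause of `𝒜_C`. -/
def IsDivFreeAncient (u : ℝ → (EuclideanSpace ℝ (Fin 3)) → (EuclideanSpace ℝ (Fin 3))) : Prop :=
  ∀ t < 0, VectorCalculus.IsDivFree (u t)

/-- The KNSS-gauge clause of `𝒜_C`: the Oseen integral equation between all times `s < t < 0`,
verbatim from the crux. -/
def IsKNSSMild (u : ℝ → (EuclideanSpace ℝ (Fin 3)) → (EuclideanSpace ℝ (Fin 3))) : Prop :=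
  ∀ s t : ℝ, s < t → t < 0 → ∀ x, u t x = heatFlow (u s) (t - s) x -
    ∫ τ in Set.Ioo s t, ∫ y, oseenKernel (t - τ) (x - y) (u τ y) (u τ y)

/-- Membership in the Type-I moduli class `𝒜_C` of the route (the four hypotheses of the crux). -/
def InClass (C : ℝ) (u : ℝ → (EuclideanSpace ℝ (Fin 3)) → (EuclideanSpace ℝ (Fin 3))) : Prop :=
  IsSmoothAncient u ∧ IsDivFreeAncient u ∧ IsKNSSMild u ∧ HasTypeITimeDecay C u

/-- Skew-symmetry of the rotation generator, as written in the crux. -/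
def IsSkew (A : (EuclideanSpace ℝ (Fin 3)) →L[ℝ] (EuclideanSpace ℝ (Fin 3))) : Prop := ∀ x, ⟪A x, x⟫ = 0

/-- `L_ξ u ≡ 0` on `t < 0` for `ξ = (a, σ, A)`: the symmetry clause of the crux, verbatim. -/
def HasSymmetry (u : ℝ → (EuclideanSpace ℝ (Fin 3)) → (EuclideanSpace ℝ (Fin 3))) (a : (EuclideanSpace ℝ (Fin 3))) (σ : ℝ)
    (A : (EuclideanSpace ℝ (Fin 3)) →L[ℝ] (EuclideanSpace ℝ (Fin 3))) : Prop :=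
  ∀ t < 0, ∀ x, fderiv ℝ (u t) x (a + σ • x + A x) + σ • u t x +
    (2 * σ * t) • timeDeriv u t x - A (u t x) = 0

/-- The conclusion of the crux. -/
def VanishesOnPast (u : ℝ → (EuclideanSpace ℝ (Fin 3)) → (EuclideanSpace ℝ (Fin 3))) : Prop := ∀ t < 0, ∀ x, u t x = 0

/-- The crux, unbundled; `Iff.rfl`, so the negative lemmas below speak about the route decl itself. -/
theorem symmetricLiouville_iff :
    SymmetricLiouville ↔ ∀ (C : ℝ) (u : ℝ → (EuclideanSpace ℝ (Fin 3)) → (EuclideanSpace ℝ (Fin 3))), InClass C u →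
      ∀ (a : (EuclideanSpace ℝ (Fin 3))) (σ : ℝ) (A : (EuclideanSpace ℝ (Fin 3)) →L[ℝ] (EuclideanSpace ℝ (Fin 3))),
        IsSkew A → ¬ (a = 0 ∧ σ = 0 ∧ A = 0) → HasSymmetry u a σ A → VanishesOnPast u :=
  Iff.rfl

/-! ## Two explicit fields (built on the sibling's unit vector `f0`) -/

/-- `f₀ ≠ 0`. -/
theorem f0_ne_zero : f0 ≠ 0 := by
  intro h
  have := norm_f0
  rw [h, norm_zero] at this
  exact zero_ne_one this

/-- `ξ = (f₀, 0, 0) ≠ 0`. -/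
theorem xi_f0_ne_zero :
    ¬ (f0 = 0 ∧ (0 : ℝ) = 0 ∧ (0 : (EuclideanSpace ℝ (Fin 3)) →L[ℝ] (EuclideanSpace ℝ (Fin 3))) = 0) :=
  fun h => f0_ne_zero h.1

/-- The constant field `u ≡ f₀`. -/
def constField : ℝ → (EuclideanSpace ℝ (Fin 3)) → (EuclideanSpace ℝ (Fin 3)) := fun _ _ => f0

/-- The parasitic field `u(t, x) = (1 − t)⁻¹ • f₀` (spatially constant, Type-I with `C = 1`). -/
def parasiticField : ℝ → (EuclideanSpace ℝ (Fin 3)) → (EuclideanSpace ℝ (Fin 3)) := fun t _ => (1 - t)⁻¹ • f0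

/-- The constant field is smooth. -/
theorem constField_smooth : IsSmoothAncient constField :=
  contDiffOn_const

/-- The parasitic field is smooth on `t < 0` (indeed on `t < 1`). -/
theorem parasiticField_smooth : IsSmoothAncient parasiticField := by
  unfold IsSmoothAncient parasiticField
  have h1 : ContDiffOn ℝ (⊤ : ℕ∞) (fun p : ℝ × (EuclideanSpace ℝ (Fin 3)) => (1 - p.1)⁻¹)
      (Set.Iio 0 ×ˢ Set.univ) := by
    refine ContDiffOn.inv ?_ ?_
    · exact (contDiffOn_const.sub contDiff_fst.contDiffOn)
    · rintro ⟨t, x⟩ ⟨ht, -⟩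
      simp only [Set.mem_Iio] at ht
      exact ne_of_gt (by linarith)
  exact h1.smul contDiffOn_const

/-- The constant field is divergence free (sibling `isDivFree_fun_const`). -/
theorem constField_divFree : IsDivFreeAncient constField := fun _ _ => isDivFree_fun_const f0

/-- The parasitic field is divergence free. -/
theorem parasiticField_divFree : IsDivFreeAncient parasiticField := fun t _ =>
  isDivFree_fun_const ((1 - t)⁻¹ • f0)

/-- **Gauge sanity**: the constant field satisfies the in-tree KNSS/Oseen integral equation
(sibling `const_mild`: `e^{σΔ} c = c` and `∫ K(σ, x − y)[c, c] dy = 0`, KNSS 2009 Rem. 6.1). -/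
theorem constField_mild : IsKNSSMild constField := fun _ _ hst _ x => const_mild f0 hst x

/-- A spatially constant field is invariant under every translation (sibling
`translation_symm_of_spatially_const`). -/
theorem hasSymmetry_translation_of_const (b : ℝ → (EuclideanSpace ℝ (Fin 3))) (a : (EuclideanSpace ℝ (Fin 3))) :
    HasSymmetry (fun t _ => b t) a 0 0 := fun t _ x => translation_symm_of_spatially_const b a t x

/-- The constant field is invariant under the translation `ξ = (f₀, 0, 0)`. -/
theorem constField_symm : HasSymmetry constField f0 0 0 :=
  hasSymmetry_translation_of_const (fun _ => f0) f0

/-- The parasitic field is invariant under the translation `ξ = (f₀, 0, 0)`. -/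
theorem parasiticField_symm : HasSymmetry parasiticField f0 0 0 :=
  hasSymmetry_translation_of_const (fun t => (1 - t)⁻¹ • f0) f0

/-- The constant field does not vanish on the past. -/
theorem constField_not_vanishes : ¬ VanishesOnPast constField := by
  intro h
  exact f0_ne_zero (h (-1) (by norm_num) 0)

/-- The parasitic field does not vanish on the past (`u(−1, 0) = ½ f₀`). -/
theorem parasiticField_not_vanishes : ¬ VanishesOnPast parasiticField := by
  intro h
  have h1 : ((1 : ℝ) - (-1))⁻¹ • f0 = 0 := h (-1) (by norm_num) 0
  rw [smul_eq_zero] at h1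
  rcases h1 with h1 | h1
  · norm_num at h1
  · exact f0_ne_zero h1

/-- `√(−t) ≤ 1 − t` for `t < 0` (AM–GM), the inequality behind the Type-I bound of the
parasitic field. -/
theorem sqrt_neg_le_one_sub {t : ℝ} (ht : t < 0) : Real.sqrt (-t) ≤ 1 - t := by
  rw [Real.sqrt_le_left (by linarith)]
  nlinarith [sq_nonneg (t + 1)]

/-- The parasitic field is Type-I with constant `1`: `(1 − t)⁻¹ ≤ 1/√(−t)`. -/
theorem parasiticField_typeI : HasTypeITimeDecay 1 parasiticField := by
  intro t ht x
  have hs : 0 < Real.sqrt (-t) := Real.sqrt_pos.2 (by linarith)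
  have h1t : 0 < 1 - t := by linarith
  simp only [parasiticField, norm_smul, norm_inv, Real.norm_eq_abs, abs_of_pos h1t, norm_f0,
    mul_one]
  rw [inv_eq_one_div]
  exact div_le_div_of_nonneg_left zero_le_one hs (sqrt_neg_le_one_sub ht)

/-- The constant field is bounded by `1`. -/
theorem constField_bounded : ∀ t < (0 : ℝ), ∀ x : (EuclideanSpace ℝ (Fin 3)), ‖constField t x‖ ≤ 1 := by
  intro t _ x
  simp [constField, norm_f0]

/-! ## Load-bearing hypotheses -/

/-- The crux with the Type-I decay hypothesis DROPPED. -/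
def SymmetricLiouvilleWithoutTypeI : Prop :=
  ∀ (u : ℝ → (EuclideanSpace ℝ (Fin 3)) → (EuclideanSpace ℝ (Fin 3))), IsSmoothAncient u → IsDivFreeAncient u → IsKNSSMild u →
    ∀ (a : (EuclideanSpace ℝ (Fin 3))) (σ : ℝ) (A : (EuclideanSpace ℝ (Fin 3)) →L[ℝ] (EuclideanSpace ℝ (Fin 3))),
      IsSkew A → ¬ (a = 0 ∧ σ = 0 ∧ A = 0) → HasSymmetry u a σ A → VanishesOnPast u

/-- **Type-I decay is load-bearing.** Without `HasTypeITimeDecay` the crux is false: the constant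
field `u ≡ f₀` is smooth, divergence free, satisfies the KNSS/Oseen integral equation (constants ARE
in the gauge class, only time-dependent constants `b(t)` are not) and is invariant under the
translation `ξ = (f₀, 0, 0)`, yet `u ≠ 0`. (Also a corollary of the sibling
`symmetricLiouville_false_typeI_near_zero_bounded_past`, whose mutant has more hypotheses.) -/
theorem symmetricLiouville_false_without_typeI : ¬ SymmetricLiouvilleWithoutTypeI := fun h =>
  constField_not_vanishes (h constField constField_smooth constField_divFree constField_mild
    f0 0 0 (fun x => by simp) xi_f0_ne_zero constField_symm)

/-- The crux with the KNSS-gauge (Oseen integral equation) hypothesis DROPPED. -/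
def SymmetricLiouvilleWithoutMild : Prop :=
  ∀ (C : ℝ) (u : ℝ → (EuclideanSpace ℝ (Fin 3)) → (EuclideanSpace ℝ (Fin 3))), IsSmoothAncient u → IsDivFreeAncient u →
    HasTypeITimeDecay C u →
    ∀ (a : (EuclideanSpace ℝ (Fin 3))) (σ : ℝ) (A : (EuclideanSpace ℝ (Fin 3)) →L[ℝ] (EuclideanSpace ℝ (Fin 3))),
      IsSkew A → ¬ (a = 0 ∧ σ = 0 ∧ A = 0) → HasSymmetry u a σ A → VanishesOnPast u

/-- **The gauge is load-bearing.** Without the Oseen integral equation the crux is false: the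
parasitic field `u(t, x) = (1 − t)⁻¹ • f₀` (KNSS 2009 §1: the solutions `b(t)`, `∇p = −b'(t)·x`
that the mild formulation removes) is smooth on `t < 1`, divergence free, Type-I with `C = 1`
(`(1−t)⁻¹ ≤ (−t)^{-1/2}` by AM–GM) and translation invariant, yet nonzero. (Also a corollary of the
sibling `symmetricLiouville_false_mild_on_window`, whose mutant has more hypotheses; the witness
here is the genuinely parasitic `b(t)` rather than a faded constant.) -/
theorem symmetricLiouville_false_without_mild : ¬ SymmetricLiouvilleWithoutMild := fun h =>
  parasiticField_not_vanishes (h 1 parasiticField parasiticField_smooth parasiticField_divFree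
    parasiticField_typeI f0 0 0 (fun x => by simp) xi_f0_ne_zero parasiticField_symm)

/-- The crux with Type-I decay REPLACED by boundedness `‖u(t,x)‖ ≤ C` (the natural "bounded
ancient" version). -/
def SymmetricLiouvilleBounded : Prop :=
  ∀ (C : ℝ) (u : ℝ → (EuclideanSpace ℝ (Fin 3)) → (EuclideanSpace ℝ (Fin 3))), IsSmoothAncient u → IsDivFreeAncient u →
    IsKNSSMild u → (∀ t < 0, ∀ x, ‖u t x‖ ≤ C) →
    ∀ (a : (EuclideanSpace ℝ (Fin 3))) (σ : ℝ) (A : (EuclideanSpace ℝ (Fin 3)) →L[ℝ] (EuclideanSpace ℝ (Fin 3))),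
      IsSkew A → ¬ (a = 0 ∧ σ = 0 ∧ A = 0) → HasSymmetry u a σ A → VanishesOnPast u

/-- **Refuted natural variant**: the bounded-ancient version with conclusion `u ≡ 0` is false
(constant field). A bounded-ancient symmetric Liouville theorem must conclude "`u` is constant"
(as KNSS 2009 Thm 5.1 / Rem. 6.1 do); the Type-I rate is what upgrades "constant" to "zero". -/
theorem symmetricLiouville_false_with_bounded : ¬ SymmetricLiouvilleBounded := fun h =>
  constField_not_vanishes (h 1 constField constField_smooth constField_divFree constField_mild
    constField_bounded f0 0 0 (fun x => by simp) xi_f0_ne_zero constField_symm)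

end Summit.NavierStokesRegularity.NavierStokesRegularity.Theorems.SymmetricLiouville.Negative

end
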